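import Literature.NumberTheory.PAdicHodge.TateH1BdRFilOfTS1
import Literature.NumberTheory.PAdicHodge.TateSenConditionHolds
import HarnessLib

/-!
# Kato, LNM 1553, Ch. II §1.2.7 / Prop. 1.2.3: the discharges

`Proofs`-style sibling (theorems only) of `TateH1BdRFil.lean`, `DualExpOfDeRham.lean` and `DualExpElliptic.lean`,
closing THREE named facts of the tree UNCONDITIONALLY, for every non-archimedean local field `F` of
characteristic `0`, every prime `p` below it and every `ℚ_p`-algebra structure on `F`:

* `kato1993_H1_bdRFil_holds` — Kato II §1.2.7 for `V = ℚ_p` (`H¹(K, B^m_dR) = 0` for `m ≥ 1`,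
  `= K · log χ_cyclo` for `m ≤ 0`, read on cocycles of finite type);
* `hasDualExp_of_isDeRham_holds` — Kato II Prop. 1.2.3, surjectivity half: every continuous cocycle of a
  de Rham `V` admits a dual exponential;
* `cupLogInjective_and_hasDualExp_of_isDeRham_holds` — both halves of Kato II Prop. 1.2.3 (`i = 0`) for every
  de Rham `V` (the binder hP of the BSD cells' `exp*` packages).

Proof: each fact was reduced in `TateH1BdRFilOfTS1` (`BdRH1Devissage.*_of_TS1`: filtered comparison for de
Rham `V`, Kato's `t`-adic dévissage of `H¹(K, B^m_dR)`, continuity of the `Γ_F`-action on `B_dR⁺`) to Tate's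
(TS1) `tate1967_TS1_completedAlgClosure` ALONE, and (TS1) is now the theorem
`tate1967_TS1_completedAlgClosure_holds` (`TateSenConditionHolds`: the elementary Kummer route + the tame
structure theorem over `ℚ_p(ζ_{p^∞})`). Also recorded: the hypothesis-free forms of the two `ℂ_F`-level
consequences of (TS1) (`H¹_cont(H₀, ℂ_F) = 0`, `H¹_cont(H_F, ℂ_F) = 0`; Tate 1967 §3.2 Prop. 10) and of Kato II
§1.2.7 for general continuous cocycles. No definition, no `sorry`; nothing about BSD is proved here.
[cite: Kato1993LNM1553, Ch. II Prop. 1.2.3 and §1.2.7] [cite: Tate1967, §3.2 Prop. 9–10, §3.3 Thms. 1–2]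
[cite: BergerColmez2008, Prop. 4.1.1]
-/

noncomputable section

open scoped TensorProduct
open ValuativeRel Field
open Literature.NumberTheory.GaloisRepresentations
open Literature.NumberTheory.GaloisRepresentations.IsNonarchimedeanLocalField

namespace Literature.NumberTheory.PAdicHodge

/-- **Kato, LNM 1553, II §1.2.7 for `V = ℚ_p` holds** — `kato1993_H1_bdRFil` is a theorem: for a `p`-adic field
`F`, `m : ℤ`, a finite family `β_j ∈ Fil^m B_dR(F)` and continuous `f_j : Γ_F → ℚ_p` with `c(σ) = Σ_j f_j(σ) β_j`
a `1`-cocycle, there are `b ∈ Fil^m B_dR(F)` and `a ∈ F` (`a = 0` if `1 ≤ m`) with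
`c(σ) = σ b − b + log χ_cyclo(σ) · a`. Proof: `BdRH1Devissage.kato1993_H1_bdRFil_of_TS1` applied to
`tate1967_TS1_completedAlgClosure_holds`. [cite: Kato1993LNM1553, Ch. II §1.2.7 (with §1.2.5–1.2.6)] [cite: Tate1967, §3.3 Theorems 1–2] -/
theorem kato1993_H1_bdRFil_holds : kato1993_H1_bdRFil :=
  BdRH1Devissage.kato1993_H1_bdRFil_of_TS1 tate1967_TS1_completedAlgClosure_holds

/-- **Kato, LNM 1553, II Prop. 1.2.3 (surjectivity half) holds for every de Rham `V`** —
`hasDualExp_of_isDeRham` is a theorem: for a `p`-adic field `F` and a finite-dimensional de Rham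
`ℚ_p`-representation `V` of `Γ_F`, every continuous crossed homomorphism `z : Γ_F → V` admits a dual
exponential (`[1 ⊗ z] = x ∪ log χ_cyclo` in `H¹(F, B⁺_dR ⊗ V)` for some `x ∈ D⁰_dR(V)`).
[cite: Kato1993LNM1553, Ch. II Prop. 1.2.3 and §1.2.7] -/
theorem hasDualExp_of_isDeRham_holds : hasDualExp_of_isDeRham :=
  BdRH1Devissage.hasDualExp_of_isDeRham_of_TS1 tate1967_TS1_completedAlgClosure_holds

/-- **Both halves of Kato, LNM 1553, II Prop. 1.2.3 (`i = 0`) hold for every de Rham `V`** —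
`cupLogInjective_and_hasDualExp_of_isDeRham` is a theorem: `x ↦ x ∪ log χ_cyclo` is injective on `D⁰_dR(V)`
and every continuous cocycle admits a dual exponential. [cite: Kato1993LNM1553, Ch. II Prop. 1.2.3] -/
theorem cupLogInjective_and_hasDualExp_of_isDeRham_holds : cupLogInjective_and_hasDualExp_of_isDeRham :=
  BdRH1Devissage.cupLogInjective_and_hasDualExp_of_isDeRham_of_TS1 tate1967_TS1_completedAlgClosure_holds

/-- **`H¹_cont(H₀, ℂ_F) = 0`** for `H₀ = ker χ = Gal(F̄/ℚ_p(μ_{p^∞})) ≤ Gal(F̄/ℚ_p)` (Tate 1967 §3.2 Prop. 10;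
Berger–Colmez 2008 Cor. 3.2.2), UNCONDITIONALLY: every continuous crossed homomorphism `c : H₀ → ℂ_F` is a
coboundary. (`baseKer_exists_eq_smul_sub` with (TS1) discharged.) [cite: Tate1967, §3.2 Prop. 10] [cite: BergerColmez2008, Cor. 3.2.2] -/
theorem baseKer_exists_eq_smul_sub_holds
    {F : Type} [Field F] [ValuativeRel F] [TopologicalSpace F] [IsNonarchimedeanLocalField F] [CharZero F]
    {p : ℕ} [Fact p.Prime] (hp : valuation F p < 1)
    (c : (BaseGaloisGroup.baseCyclotomicCharacter hp).ker → CompletedAlgClosure F)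
    (hc : ∀ g h : (BaseGaloisGroup.baseCyclotomicCharacter hp).ker, c (g * h) = c g + g • c h)
    (hcont : Continuous c) :
    ∃ b : CompletedAlgClosure F, ∀ g : (BaseGaloisGroup.baseCyclotomicCharacter hp).ker, c g = g • b - b :=
  baseKer_exists_eq_smul_sub tate1967_TS1_completedAlgClosure_holds hp c hc hcont

/-- **`H¹_cont(H_F, ℂ_F) = 0`** over `F` itself (`H_F = ker χ_F ≤ Γ_F`, tree `Sen.kerCyclotomic F p`),
UNCONDITIONALLY (`kerCyclotomic_exists_eq_smul_sub` with (TS1) discharged). [cite: Tate1967, §3.2 Prop. 10] [cite: BergerColmez2008, Cor. 3.2.2] -/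
theorem kerCyclotomic_exists_eq_smul_sub_holds
    {F : Type} [Field F] [ValuativeRel F] [TopologicalSpace F] [IsNonarchimedeanLocalField F] [CharZero F]
    (p : ℕ) [Fact p.Prime] (hp : valuation F p < 1)
    (c : Sen.kerCyclotomic F p → CompletedAlgClosure F)
    (hc : ∀ g h : Sen.kerCyclotomic F p, c (g * h) = c g + g • c h) (hcont : Continuous c) :
    ∃ b : CompletedAlgClosure F, ∀ g : Sen.kerCyclotomic F p, c g = g • b - b :=
  kerCyclotomic_exists_eq_smul_sub tate1967_TS1_completedAlgClosure_holds p hp c hc hcont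

namespace BdRH1Devissage

variable {F : Type} [Field F] [ValuativeRel F] [TopologicalSpace F] [IsNonarchimedeanLocalField F]
  [CharZero F] {p : ℕ} [Fact p.Prime] [Fact (¬ IsUnit (p : integerC F))]
  [IsAdicComplete (Ideal.span {(p : integerC F)}) (integerC F)]

/-- **Kato, LNM 1553, II §1.2.7 for `V = ℚ_p`, GENERAL continuous cocycles, UNCONDITIONALLY**: for a `p`-adic
field `F`, `m ∈ ℤ` and every `1`-cocycle `c : Γ_F → Fil^m B_dR(F)` of the form `c = t^m z` with
`z : Γ_F → B_dR⁺` continuous for Fontaine's topology, `c = ∂b + log χ_cyclo · a` with `b ∈ Fil^m`, `a ∈ F`,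
`a = 0` if `m ≥ 1` (`H¹_cont(K, B^m_dR) = K · log χ` for `m ≤ 0`, `= 0` for `m ≥ 1`).
(`exists_eq_coboundary_add_logCyclotomic_of_TS1` with (TS1) discharged.)
[cite: Kato1993LNM1553, Ch. II §1.2.5–1.2.7] [cite: Tate1967, §3.3 Theorems 1–2] -/
theorem exists_eq_coboundary_add_logCyclotomic
    (hp : valuation F p < 1) [Algebra ℚ_[p] F] [IsDomain (BDeRhamPlus (integerC F) p)] (m : ℤ)
    (c : absoluteGaloisGroup F → (bdRPeriodRingData (F := F) (p := p) hp).B)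
    (hc : ∀ σ τ : absoluteGaloisGroup F, c (σ * τ) = c σ + σ • c τ)
    (hcts : ∃ z : absoluteGaloisGroup F → BDeRhamPlus (integerC F) p,
      (∀ n k : ℕ, ∃ U : OpenSubgroup (absoluteGaloisGroup F), ∀ σ : absoluteGaloisGroup F, ∀ τ ∈ U,
        ∃ (a : Ainf (p := p) F) (w : BDeRhamPlus (integerC F) p),
          z (σ * τ) - z σ = ainfToBdR ((p : Ainf (p := p) F) ^ n * a) + xiBdR ^ k * w) ∧
      ∀ σ, c σ = algebraMap (BDeRhamPlus (integerC F) p) (FracBdR F p) tBdR ^ m *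
        algebraMap (BDeRhamPlus (integerC F) p) (FracBdR F p) (z σ)) :
    ∃ b ∈ (bdRPeriodRingData (F := F) (p := p) hp).fil m, ∃ a : F, (1 ≤ m → a = 0) ∧
      ∀ σ : absoluteGaloisGroup F, c σ = σ • b - b +
        algebraMap ℚ_[p] (bdRPeriodRingData (F := F) (p := p) hp).B (logCyclotomic p σ) *
          algebraMap F (bdRPeriodRingData (F := F) (p := p) hp).B a :=
  exists_eq_coboundary_add_logCyclotomic_of_TS1 tate1967_TS1_completedAlgClosure_holds hp m c hc hcts

end BdRH1Devissage

end Literature.NumberTheory.PAdicHodge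

end
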